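import Summits.Ventures.CertifiedQuantumChemistry.Rows.SOSDualSemantics
import Summits.Ventures.CertifiedQuantumChemistry.Rows.LowerCertificateCompleteness
import HarnessLib

/-!
# Ventures/CertifiedQuantumChemistry — Rows/SOSDualReplay.lean: KERNEL REPLAY of an SDP dual (sum-of-squares) lower
# certificate — `LowerRow` / `LowerCertificate` from integer factor data by normal ordering (part 3 of 3)

HONEST FRAMING (verbatim): certified bounds for a stated model Hamiltonian in a stated basis; not a
claim about the real molecule beyond that model.

var-2 (gen 17), zero compute, PROVED glue only (0 sorry, no claim node, no model instance, NO BOUND ASSERTED about any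
file of record; instances live in `Certificates/`).

* `termOp_multTermsOf` (`= q • (X (N̂_τ − n) + (N̂_τ − n) X†)`), `sum_numberOp_up/down_mulVec'`,
  `dotProduct_idealTerm_eq_zero`, **`dotProduct_multTerms_eq_zero`**: the multiplier part VANISHES on every vector of the
  `(a, b)` sector;
* **`lowerRow_of_evalPoly_eq`**: for a symmetric model, `a, b ≤ k`, ANY certificate data `c` and any polynomial `P` with
  `evalPoly id P = termOp (certTerms F a b c)`: `lo ≤ E_core + lowerConst P → LowerRow F a b lo` (Gram part `≥ 0` by
  `re_gramTermsOf_nonneg`, ideal part `= 0`, the rest bounded by `re_quadForm_evalPoly_ge`, and the typer's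
  `lowerRow_of_forall_isInSector`); **`lowerRow_of_sosBound`** (monolithic `P = normalize (certTerms …)`);
  **`lowerCertificate_of_evalPoly_eq`** (the cell's claim-node predicate, by the typer's completeness theorem
  `lowerCertificate_of_lowerRow`). NOTHING about the data is trusted: a wrong or weak certificate only makes the bound
  useless, never unsound;
* plumbing for BLOCK-WISE replay (one kernel evaluation per block, needed because a whole certificate exceeds the kernel's
  memory budget): `termOp_certTerms` (three pieces), `termOp_negTerms_gramTermsL_cons` (one block peeled),
  `evalPoly_chainStep` (`collect (C ++ normalize T)` denotes `C + T`), `evalPoly_final`. Instance files produce the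
  intermediate collected polynomials with `eval%` and have the kernel re-check each step (`decide +kernel`); first
  instance `Certificates/HubbardRingL6U1DQGKernel.lean` (the L node of CERTIFIED row #59).

References: FORMAT-qcl1 v0.3.0 §2–§7; Jansson–Chaykin–Keil, SIAM J. Numer. Anal. 46 (2007) 180; the cell's readers
`certsdp.verify_a` / `verify_b` establish the same bound outside the kernel.
-/

namespace Summit.Ventures.CertifiedQuantumChemistry

open Matrix
open Literature.MathematicalPhysics.QuantumLattice Literature.MathematicalPhysics.QuantumChemistry
open CARPoly
open scoped ComplexOrder

namespace SOSDual

/-! ### Multipliers of the sector ideals: they vanish on sector vectors -/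

section Mult

variable {k : ℕ}

/-- The number word denotes the number operator `n_{yτ}`. -/
theorem ladderWord_numWord (y : Fin k) (τ : Fin 2) : ladderWord (numWord y τ) = numberOp y τ := by
  simp [numWord, ladderWord_cons, ladderLetter, numberOp]

/-- The multiplier term list denotes `q · (X (N̂_τ − n) + (N̂_τ − n) X†)`. -/
theorem termOp_multTermsOf (q : ℚ) (X : List (Orb (Fin k) × Bool)) (τ : Fin 2) (n : ℕ) :
    termOp (multTermsOf q X τ n) = ((q : ℚ) : ℂ) •
      (ladderWord X * (∑ y : Fin k, numberOp y τ - (n : ℂ) • 1) +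
        (∑ y : Fin k, numberOp y τ - (n : ℂ) • 1) * (ladderWord X)ᴴ) := by
  unfold multTermsOf
  rw [termOp_append, termOp_flatMap, termOp_cons, termOp_cons, termOp_nil, add_zero]
  have h : (List.map (fun y : Fin k => termOp [(X ++ numWord y τ, q), (numWord y τ ++ dagger X, q)]) (finList k)).sum =
      ∑ y : Fin k, ((q : ℚ) : ℂ) • (ladderWord X * numberOp y τ + numberOp y τ * (ladderWord X)ᴴ) := by
    rw [← sum_map_finList]
    congr 1
    refine List.map_congr_left fun y _ => ?_
    rw [termOp_cons, termOp_cons, termOp_nil, add_zero, ladderWord_append', ladderWord_append', ladderWord_numWord,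
      ladderWord_dagger, smul_add]
  rw [h, ← Finset.smul_sum, Finset.sum_add_distrib, ← Finset.mul_sum, ← Finset.sum_mul, ladderWord_dagger,
    Rat.cast_neg, Rat.cast_mul, Rat.cast_natCast]
  simp only [mul_sub, sub_mul, smul_add, smul_sub, Matrix.mul_smul, Matrix.smul_mul, Matrix.mul_one, Matrix.one_mul,
    neg_smul, mul_smul]
  rw [show ((n : ℂ) • ladderWord X) = ((n : ℚ) : ℂ) • ladderWord X by rw [Rat.cast_natCast],
    show ((n : ℂ) • (ladderWord X)ᴴ) = ((n : ℚ) : ℂ) • (ladderWord X)ᴴ by rw [Rat.cast_natCast]]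
  simp only [Rat.cast_natCast]
  abel

/-- `N̂_τ` is self-adjoint. -/
theorem conjTranspose_sum_numberOp (τ : Fin 2) : (∑ y : Fin k, numberOp y τ)ᴴ = ∑ y : Fin k, numberOp y τ := by
  rw [Matrix.conjTranspose_sum]
  refine Finset.sum_congr rfl fun y _ => ?_
  rw [numberOp, conjTranspose_mul, creation_conjTranspose, annihilation_conjTranspose]

/-- `N̂_↑ ψ = a ψ` on the sector `(a, b)`. -/
theorem sum_numberOp_up_mulVec' {a b : ℕ} {ψ : Fock (Orb (Fin k))} (hψ : IsInSector a b ψ) :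
    (∑ y : Fin k, numberOp y 0) *ᵥ ψ = (a : ℂ) • ψ := by
  funext s
  rw [Matrix.sum_mulVec, Finset.sum_apply, Pi.smul_apply, smul_eq_mul]
  simp only [LiebThm1.numberOp_eq_diagonal, mulVec_diagonal]
  rw [← Finset.sum_mul, Finset.sum_boole]
  by_cases hs : (upPart s).card = a ∧ (downPart s).card = b
  · rw [← hs.1]; rfl
  · rw [hψ s hs, mul_zero, mul_zero]

/-- `N̂_↓ ψ = b ψ` on the sector `(a, b)`. -/
theorem sum_numberOp_down_mulVec' {a b : ℕ} {ψ : Fock (Orb (Fin k))} (hψ : IsInSector a b ψ) :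
    (∑ y : Fin k, numberOp y 1) *ᵥ ψ = (b : ℂ) • ψ := by
  funext s
  rw [Matrix.sum_mulVec, Finset.sum_apply, Pi.smul_apply, smul_eq_mul]
  simp only [LiebThm1.numberOp_eq_diagonal, mulVec_diagonal]
  rw [← Finset.sum_mul, Finset.sum_boole]
  by_cases hs : (upPart s).card = a ∧ (downPart s).card = b
  · rw [← hs.2]; rfl
  · rw [hψ s hs, mul_zero, mul_zero]

/-- A two-sided multiple of `N̂_τ − n` has zero expectation in any vector with `N̂_τ ψ = n ψ`. -/
theorem dotProduct_idealTerm_eq_zero (X N : Op k) (hN : Nᴴ = N) (n : ℕ) (ψ : Fock (Orb (Fin k)))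
    (hψ : N *ᵥ ψ = (n : ℂ) • ψ) :
    star ψ ⬝ᵥ ((X * (N - (n : ℂ) • 1) + (N - (n : ℂ) • 1) * Xᴴ) *ᵥ ψ) = 0 := by
  have h0 : (N - (n : ℂ) • (1 : Op k)) *ᵥ ψ = 0 := by
    rw [Matrix.sub_mulVec, hψ, Matrix.smul_mulVec, Matrix.one_mulVec, sub_self]
  have hH : (N - (n : ℂ) • (1 : Op k))ᴴ = N - (n : ℂ) • 1 := by
    rw [conjTranspose_sub, hN, conjTranspose_smul, conjTranspose_one, Complex.star_def, Complex.conj_natCast]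
  rw [Matrix.add_mulVec, dotProduct_add, ← mulVec_mulVec, h0, Matrix.mulVec_zero, dotProduct_zero, zero_add,
    ← mulVec_mulVec, dotProduct_mulVec, ← hH, ← star_mulVec, h0, star_zero, zero_dotProduct]

/-- **The multiplier part vanishes on every vector of the sector.** -/
theorem dotProduct_multTerms_eq_zero [NeZero k] {a b : ℕ} (c : Cert) {ψ : Fock (Orb (Fin k))}
    (hψ : IsInSector a b ψ) : star ψ ⬝ᵥ (termOp (multTerms k a b c) *ᵥ ψ) = 0 := by
  unfold multTerms
  rw [termOp_flatMap, listSum_mulVec, dotProduct_listSum]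
  refine List.sum_eq_zero fun x hx => ?_
  obtain ⟨M, -, rfl⟩ := List.mem_map.1 hx
  rw [termOp_multTermsOf, Matrix.smul_mulVec, dotProduct_smul, smul_eq_zero]
  right
  refine dotProduct_idealTerm_eq_zero _ _ (conjTranspose_sum_numberOp _) _ ψ ?_
  unfold Mult.tau
  by_cases h : M.spin = 0
  · rw [if_pos h, if_pos h]; exact sum_numberOp_up_mulVec' hψ
  · rw [if_neg h, if_neg h]; exact sum_numberOp_down_mulVec' hψ

end Mult

/-! ## The replay theorem -/

section Main

variable {k : ℕ}

/-- The Gram part of the whole certificate is nonnegative on every vector. -/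
theorem re_gramTerms_nonneg [NeZero k] (c : Cert) (v : Fock (Orb (Fin k))) :
    0 ≤ (star v ⬝ᵥ (termOp (gramTerms k c) *ᵥ v)).re := by
  unfold gramTerms gramTermsL
  rw [termOp_flatMap, listSum_mulVec, dotProduct_listSum, re_listSum]
  refine List.sum_nonneg fun x hx => ?_
  obtain ⟨B, -, rfl⟩ := List.mem_map.1 hx
  exact re_gramTermsOf_nonneg _ _ _

/-- With integral accessors that AGREE with the model, `hamTermsWith` denotes `H_F − E_core·1` too. -/
theorem termOp_hamTermsWith (F : Model k) {H : Fin k → Fin k → ℚ} {V : Fin k → Fin k → Fin k → Fin k → ℚ}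
    (hH : ∀ p q, H p q = F.h p q) (hV : ∀ p q r s, V p q r s = F.eri p q r s) :
    termOp (hamTermsWith H V) = F.hamiltonian - (F.ecore : ℂ) • (1 : Op k) := by
  have h1 : H = F.h := funext fun p => funext fun q => hH p q
  have h2 : V = F.eri := funext fun p => funext fun q => funext fun r => funext fun s => hV p q r s
  subst h1 h2
  rw [← hamTerms_eq_hamTermsWith, termOp_hamTerms]

/-- **KERNEL REPLAY OF AN SOS / DUAL CERTIFICATE (pieces form).** For a symmetric model, a sector in range and ANY
certificate data `c`: if `HT` denotes `H_F − E_core·1` (e.g. `hamTerms F`, or `hamTermsWith` at fast accessors proved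
equal to the model's), `P` denotes `HT − Gram − Mult` (e.g. a block-wise pre-collected polynomial) and
`lo ≤ E_core + constCoeff P − ℓ¹(P)`, then `LowerRow F a b lo`. -/
theorem lowerRow_of_pieces [NeZero k] {F : Model k} (hF : F.IsSymmetric) {a b : ℕ} (ha : a ≤ k) (hb : b ≤ k)
    (c : Cert) (P : CARPoly.Poly (Orb (Fin k))) (HT : Terms k)
    (hHT : termOp HT = F.hamiltonian - (F.ecore : ℂ) • (1 : Op k))
    (hP : evalPoly id P = termOp HT + termOp (negTerms (gramTerms k c)) + termOp (negTerms (multTerms k a b c)))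
    {lo : ℚ} (h : lo ≤ F.ecore + lowerConst P) : LowerRow F a b lo := by
  refine lowerRow_of_forall_isInSector hF ha hb fun ψ hψ => ?_
  have hq := re_quadForm_evalPoly_ge id P ψ
  rw [hP, hHT, termOp_negTerms, termOp_negTerms,
    Matrix.add_mulVec, Matrix.add_mulVec, Matrix.sub_mulVec, Matrix.neg_mulVec, Matrix.neg_mulVec,
    dotProduct_add, dotProduct_add, dotProduct_sub, dotProduct_neg, dotProduct_neg,
    dotProduct_multTerms_eq_zero c hψ, Matrix.smul_mulVec, Matrix.one_mulVec, dotProduct_smul, smul_eq_mul]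
    at hq
  have hG := re_gramTerms_nonneg c ψ (k := k)
  have hE : (((F.ecore : ℚ) : ℂ) * (star ψ ⬝ᵥ ψ)).re = ((F.ecore : ℚ) : ℝ) * (star ψ ⬝ᵥ ψ).re := by
    rw [← Complex.ofReal_ratCast, Complex.re_ofReal_mul]
  simp only [Complex.add_re, Complex.sub_re, Complex.neg_re, neg_zero, add_zero, hE] at hq
  have hnn : 0 ≤ (star ψ ⬝ᵥ ψ).re := (Complex.nonneg_iff.1 (dotProduct_star_self_nonneg _)).1
  have hlo : ((lo : ℚ) : ℝ) ≤ ((F.ecore : ℚ) : ℝ) + ((lowerConst P : ℚ) : ℝ) := by exact_mod_cast h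
  nlinarith [mul_nonneg (sub_nonneg.2 hlo) hnn]

/-- **KERNEL REPLAY OF AN SOS / DUAL CERTIFICATE.** For a symmetric model, a sector in range and ANY certificate data `c`:
if a polynomial `P` denotes the operator of `certTerms F a b c` (e.g. `P = normalize … (certTerms F a b c)`, or a
block-wise pre-collected version of it) and `lo ≤ E_core + constCoeff P − ℓ¹(P)`, then `LowerRow F a b lo`. -/
theorem lowerRow_of_evalPoly_eq [NeZero k] {F : Model k} (hF : F.IsSymmetric) {a b : ℕ} (ha : a ≤ k) (hb : b ≤ k)
    (c : Cert) (P : CARPoly.Poly (Orb (Fin k))) (hP : evalPoly id P = termOp (certTerms F a b c)) {lo : ℚ}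
    (h : lo ≤ F.ecore + lowerConst P) : LowerRow F a b lo :=
  lowerRow_of_pieces hF ha hb c P (hamTerms F) (termOp_hamTerms F)
    (by rw [hP, certTerms, termOp_append, termOp_append]) h

/-- **Monolithic form**: `lo ≤ sosBound F a b c → LowerRow F a b lo` (`decide +kernel` for small certificates). -/
theorem lowerRow_of_sosBound [NeZero k] {F : Model k} (hF : F.IsSymmetric) {a b : ℕ} (ha : a ≤ k) (hb : b ≤ k)
    (c : Cert) {lo : ℚ} (h : lo ≤ sosBound F a b c) : LowerRow F a b lo :=
  lowerRow_of_evalPoly_eq hF ha hb c _ (evalPoly_normalize_id _ _ _) h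

/-- The cell's claim-node predicate from the replay (typer's completeness `lowerCertificate_of_lowerRow`). -/
theorem lowerCertificate_of_evalPoly_eq [NeZero k] {F : Model k} (hF : F.IsSymmetric) {a b : ℕ} (ha : a ≤ k)
    (hb : b ≤ k) (c : Cert) (P : CARPoly.Poly (Orb (Fin k))) (hP : evalPoly id P = termOp (certTerms F a b c)) {lo : ℚ}
    (h : lo ≤ F.ecore + lowerConst P) : LowerCertificate F a b lo :=
  lowerCertificate_of_lowerRow hF (lowerRow_of_evalPoly_eq hF ha hb c P hP h)

/-! ### Block-wise (chunked) replay: plumbing lemmas for instance files -/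

/-- `negTerms` of the empty list. -/
@[simp] theorem negTerms_nil : negTerms ([] : Terms k) = [] := rfl

/-- `negTerms` distributes over concatenation. -/
theorem negTerms_append (A B : Terms k) : negTerms (A ++ B) = negTerms A ++ negTerms B := by
  simp [negTerms, List.map_append]

/-- No blocks, no Gram terms. -/
theorem gramTermsL_nil [NeZero k] (K : ℕ) : gramTermsL k K [] = [] := rfl

/-- Gram terms of a cons of blocks. -/
theorem gramTermsL_cons [NeZero k] (K : ℕ) (Bk : Block) (rest : List Block) :
    gramTermsL k K (Bk :: rest) = gramTermsOf K (Bk.decode k) ++ gramTermsL k K rest := rfl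

/-- Gram terms of a concatenation of block lists. -/
theorem gramTermsL_append [NeZero k] (K : ℕ) (A B : List Block) :
    gramTermsL k K (A ++ B) = gramTermsL k K A ++ gramTermsL k K B := by
  simp [gramTermsL, List.flatMap_append]

/-- The (negated) Gram operator of a concatenation of block lists splits. -/
theorem termOp_negTerms_gramTermsL_append [NeZero k] (K : ℕ) (A B : List Block) :
    termOp (negTerms (gramTermsL k K (A ++ B))) =
      termOp (negTerms (gramTermsL k K A)) + termOp (negTerms (gramTermsL k K B)) := by
  rw [gramTermsL_append, negTerms_append, termOp_append]

/-- One block peeled off the (negated) Gram operator. -/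
theorem termOp_negTerms_gramTermsL_cons [NeZero k] (K : ℕ) (Bk : Block) (rest : List Block) :
    termOp (negTerms (gramTermsL k K (Bk :: rest))) =
      termOp (negTerms (gramTermsOf K (Bk.decode k))) + termOp (negTerms (gramTermsL k K rest)) := by
  rw [gramTermsL_cons, negTerms_append, termOp_append]

/-- The certificate operator in three pieces. -/
theorem termOp_certTerms [NeZero k] (F : Model k) (a b : ℕ) (c : Cert) :
    termOp (certTerms F a b c) =
      termOp (hamTerms F) + termOp (negTerms (gramTermsL k c.K c.blocks)) + termOp (negTerms (multTerms k a b c)) := by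
  rw [certTerms, termOp_append, termOp_append, gramTerms]

/-- Semantics of one accumulation step `collect (C ++ normalize T)`. -/
theorem evalPoly_chainStep (enc : Orb (Fin k) → ℕ) (B : ℕ) (C : CARPoly.Poly (Orb (Fin k))) (T : Terms k) :
    evalPoly id (collect enc B (C ++ CARPoly.normalize enc B T)) = evalPoly id C + termOp T := by
  rw [evalPoly_collect, evalPoly_append, evalPoly_normalize_id]

/-- Semantics of the final assembly `collect (termsToPoly (hamTerms F) ++ C)`. -/
theorem evalPoly_final (F : Model k) (enc : Orb (Fin k) → ℕ) (B : ℕ) (C : CARPoly.Poly (Orb (Fin k))) :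
    evalPoly id (collect enc B (termsToPoly (hamTerms F) ++ C)) = termOp (hamTerms F) + evalPoly id C := by
  rw [evalPoly_collect, evalPoly_append, evalPoly_termsToPoly_id]

end Main

end SOSDual

end Summit.Ventures.CertifiedQuantumChemistry
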